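import Literature.IUT.HodgeArakelov.LabelClassesOfCuspsCor24iiYddOfOrigin
import HarnessLib

/-!
# [IUTchII] Cor 2.4 (ii) (a), sub-node (a.2) at the genuine `±`-tower: the producer RE-KEYED to the level
# `Π^±_v` and to print's INTERSECTION family `I ∩ Π_v` of Def 2.3 (ii)

S. Mochizuki, *Inter-universal Teichmüller Theory II*, kurims manuscript (Dec. 2020), §2: Cor. 2.4 (ii)(a) p. 70
(«`D^δ_t := N_{Π^δ_v}(I^δ_t) ⊆ Π^δ_{v□̈}`», `I_t` a cuspidal inertia group of `Π_v`), Def. 2.3 (ii) p. 68 («the cuspidal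
inertia groups of `Π_⊆` may be obtained as the intersections with `Π_⊆` of those cuspidal inertia groups of `Π_⊇` that
contain a finite index subgroup that lies inside `Π_⊆`»), Rmk. 2.3.1 p. 69 («`I ∩ Π_⊆ = I^l`»).
[cite: Mochizuki2012, II Cor 2.4 (ii) p.70; II Def 2.3 (ii) p.68]  abc-iut cell, layer L6, node **IUTchII:Cor2.4(ii)**; seat
abc-iut-w6-d069 (gen 2), row «RE-KEY-YDD-PIPM» named by abc-iut-w4-d005 (gen 6, STATUS 2026-08-26T11:53:15Z).
PROOF-ONLY SIBLING (0 `def`, 0 `structure`, 0 `instance`) of this seat's `LabelClassesOfCuspsCor24iiYddOfCoverModel.lean`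
(p434941 / p436371, 427 l — hence no v3 append) and `…YddOfOrigin.lean` (p438495); their declarations are untouched and consumed
BY NAME (`map_YddL_ofCoverModel`, `piTemp_hX_of_cuspClauses`, `decomp_le_GtpYN_two_of_cuspSection`,
`ThetaSetting.decomp_inf_le_GtpYN_of_origin`), as are abc-iut-L6-t19's `piV_ofCoverModel` / `piPM_ofCoverModel`.

WHY.  The v1/v2 producer `cuspDecomp_one_le_map_YddL_ofCoverModel` states the closers' binder `hYdd` «for every `I` with
`Cu.IsCuspidalInertia Π_v I`» over abc-iut-w5-d132's CONTAINMENT-keyed datum of p430433 (`J` cuspidal in `Π_□` iff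
`J ≤ Π_□ ∧ J = t·ι((g·inclX I_x·g⁻¹) ∩ inclX Π^tp_{X̲})·t⁻¹`).  abc-iut-w4-d005's kernel certificate
`PlusMinusTower.isEmpty_cuspidalInertia_piV_of_containment` (p442973) shows that family is EMPTY at the level `Π_v` of the
genuine tower (granted four named [EtTh]-side inputs), so there the v1/v2 statement holds for want of instances.  Its PROOF never
uses `J ≤ Π_v` (nor `I ≤ Δ_{v□}`): it is a statement about the SHAPE `t·ι((g·inclX I_x·g⁻¹) ∩ inclX Π^tp_{X̲})·t⁻¹` alone.  Here:
§0 `cuspDecomp_inf_piV` (GENERIC: `D^δ` of `I ∩ Π_v` = `D^δ` of `I`, the bridge to print's intersection rule); §1 the datum-free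
core `…_of_shape` for every member `J` of the tempered cusp family (`t ∈ Π^±_v`) and for its trace `J ∩ Π_v`; §2 the producer
RE-KEYED AT `Π^±_v` for the containment datum, where the family is INHABITED (`exists_isCuspidalInertia_piPM_of_containment`);
§3 the producer AT `Π_v` in the EXACT binder shape `hYdd` of the node's closers (`cor24_ii_iii'_of_inputs`, …) for ANY datum `Ci`
obeying print's Def 2.3 (ii) INTERSECTION rule relative to the tempered cusp family (hypothesis `hint`); each with `hX` abstract /
discharged from the named cusp clauses (F-1704, F-1708, G-w6d069-1 at `N = 2` or from the registered origin inputs).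

HONEST LIMITS: `hX` / (F-1704, F-1708, cusp-splitting) / `hint` are HYPOTHESES, named, never asserted; no new `Prop` definition;
nothing of p430433 / p434941 / p442973 is edited or contradicted; the tree's agreement of record at `ofCoverModel` is
containment-keyed, and an intersection-keyed one (`hint` as an `↔`) is NOT constructed here.  Nothing of the series is
asserted; vacuously-true ≠ covered; no side is taken on [IUTchIII] Cor. 3.12; typed ≠ proved.
-/

noncomputable section

namespace Literature.IUT.HodgeArakelov

open Literature.AnabelianGeometry.EtaleTheta Literature.AnabelianGeometry.SemiGraphs
open scoped Pointwise

universe u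

section Conj

variable {G G' : Type*} [Group G] [Group G']

/-- Conjugation by `1` is the identity on subgroups. [folklore] -/
private theorem map_conj_one₃ (K : Subgroup G) : K.map (MulAut.conj (1 : G)).toMonoidHom = K := by
  ext y
  rw [Subgroup.mem_map_equiv, MulAut.conj_symm_apply, inv_one, one_mul, mul_one]

/-- A homomorphism intertwines conjugation: `f(t K t⁻¹) = f(t) f(K) f(t)⁻¹`. [folklore] -/
private theorem map_conj_smul₃ (f : G →* G') (t : G) (K : Subgroup G) :
    (MulAut.conj t • K).map f = MulAut.conj (f t) • K.map f := by
  ext y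
  simp only [Subgroup.mem_map, Subgroup.mem_smul_pointwise_iff_exists, MulAut.smul_def, MulAut.conj_apply]
  constructor
  · rintro ⟨x, ⟨s, hs, rfl⟩, rfl⟩
    exact ⟨f s, ⟨s, hs, rfl⟩, by rw [map_mul, map_mul, map_inv]⟩
  · rintro ⟨_, ⟨s, hs, rfl⟩, rfl⟩
    exact ⟨t * s * t⁻¹, ⟨s, hs, rfl⟩, by rw [map_mul, map_mul, map_inv]⟩

/-- Conjugating a subgroup of `K` by an element of `K` stays inside `K`. [folklore] -/
private theorem conj_smul_le_of_le_of_mem {H K : Subgroup G} (hH : H ≤ K) {t : G} (ht : t ∈ K) :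
    MulAut.conj t • H ≤ K := by
  intro y hy
  rw [Subgroup.mem_smul_pointwise_iff_exists] at hy
  obtain ⟨s, hs, rfl⟩ := hy
  exact K.mul_mem (K.mul_mem ht (hH hs)) (K.inv_mem ht)

end Conj

/-! ### §0. Generic: `D^δ` of `I ∩ Π_v` is `D^δ` of `I` -/

namespace PlusMinusTower

section Generic

variable {S : BadPlaceSetting.{u}} {P : TopGroup.{u}} {T : TemperedCoverings S P}

/-- **`N_{Π^δ_v}((I ∩ Π_v)^δ) = N_{Π^δ_v}(I^δ)`** (relative normalisers inside `Π^δ_v`): the datum (a) `D^δ_t` of Cor. 2.4 (ii)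
computed from `I` and from its trace `I ∩ Π_v` coincide (for `h ∈ Π^δ_v`, membership in `I^δ` and in `I^δ ∩ Π^δ_v` agree) — the
bridge to print's `I₀ ∩ Π_v` of Def. 2.3 (ii).  PROVED. [claim: Mochizuki2012, status: disputed] (IUTchII §2 Cor 2.4 (ii)(a) p.70) -/
theorem cuspDecomp_inf_piV (W : PlusMinusTower T) (I : Subgroup W.Corhat) (δ : W.Corhat) :
    W.cuspDecomp (I ⊓ W.piV) δ = W.cuspDecomp I δ := by
  have hinj : Function.Injective (MulAut.conj δ).toMonoidHom := (MulAut.conj δ).injective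
  ext x
  rw [W.mem_cuspDecomp_iff, W.mem_cuspDecomp_iff, Subgroup.map_inf _ _ _ hinj]
  refine and_congr_right fun hx => forall_congr' fun h => forall_congr' fun hh => ?_
  have hxh : x * h * x⁻¹ ∈ W.piV.map (MulAut.conj δ).toMonoidHom :=
    Subgroup.mul_mem _ (Subgroup.mul_mem _ hx hh) (Subgroup.inv_mem _ hx)
  rw [Subgroup.mem_inf, Subgroup.mem_inf]
  exact ⟨fun H => ⟨fun h1 => (H.1 ⟨h1, hh⟩).1, fun h2 => (H.2 ⟨h2, hxh⟩).1⟩,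
    fun H => ⟨fun h1 => ⟨H.1 h1.1, hxh⟩, fun h2 => ⟨H.2 h2.1, hh⟩⟩⟩

end Generic

/-! ### §1. The datum-free core at `W := ofCoverModel …` -/

variable {p : ℕ} [Fact p.Prime] {M : MuTwoSetting p} (e : M.CLevelData)
  {E : M.toThetaSetting.EtaleThetaData} {l : ℕ} (C : E.DoubleUnderline l) {N : ℕ+}
  (μ : M.toThetaSetting.CyclotomeMod l N) (hC : M.toThetaSetting.Compat) (hS : M.toThetaSetting.Sec2Hyps)
  (hl : l.Prime) (hp2 : p ≠ 2) (hpl : p ≠ l) (hζ : ∃ ζ : M.toThetaSetting.K, IsPrimitiveRoot ζ (4 * l))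
  {η : (C.thetaEnvData μ hC hS).PiYdd → MuN p N} (hη : η ∈ (C.thetaEnvData μ hC hS).thetaCocycles)
  {Q : Type} [Group Q] [TopologicalSpace Q] [IsTopologicalGroup Q]
  (ι : M.GtpC →ₜ* Q) (hι : IsProfiniteCompletion ι) (hinj : Function.Injective ι)
  (Φ : Q →* GQp p) (hΦ : ∀ g : M.GtpC, Φ (ι g) = e.augC g) (hΦK : Φ.range = M.GK)
  (hZ : Thm16Sub.KerToZIsCompactlyGenerated M.toThetaSetting) (hN : (C.Huu.subgroupOf (M.GtpXu l)).Normal)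
  {P : TopGroup.{0}} (T : TemperedCoverings (BadPlaceSetting.ofUnderline C μ hC hS hl hp2 hpl hζ hη) P)

/-- **Core of (a.2) at the genuine `±`-tower, DATUM-FREE** (kurims p. 70 l. 34–42): for EVERY member
`J = t·ι((g·inclX I_x·g⁻¹) ∩ inclX Π^tp_{X̲})·t⁻¹` of the tempered cusp family of `X̲_v` in `Π̂^cor_v = Q` (`x` a cusp of `X`,
`g ∈ Π^tp_C`, `t ∈ Π^±_v`) — wherever it sits — the relative normaliser `D_t = N_{Π_v}(J)` lies in the image of `Π^tp_{Ÿ̲_v}`,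
given the [SemiAnbd]/[EtTh]-side statement `hX` of the v1 file — the proof of v1's `…_of_piTemp` with its unused binders
(`J ≤ Π_v`, `J ≤ Δ_{v□}`) removed.  PROVED (`ι` injective, `Π_v = ι(inclX Π^tp_{X̲̲})`, `Π^±_v = ι(inclX Π^tp_{X̲})`,
`map_YddL_ofCoverModel`). [claim: Mochizuki2012, status: disputed] (IUTchII §2 Cor 2.4 (ii)(a) p.70) -/
theorem cuspDecomp_one_le_map_YddL_ofCoverModel_of_shape
    (hX : ∀ (x : M.Pt), M.IsCusp x → ∀ (g t₁ : M.GtpC), t₁ ∈ (M.GtpXu l).map M.inclX →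
      ∀ n₀ : M.PiTemp, n₀ ∈ C.Huu →
        (∀ h : M.GtpC, h ∈ (C.Huu : Subgroup M.PiTemp).map M.inclX →
          (h ∈ MulAut.conj t₁ •
              ((MulAut.conj g • (M.toTemperedCurve.inertia x).map M.inclX) ⊓ (M.GtpXu l).map M.inclX) ↔
            M.inclX n₀ * h * (M.inclX n₀)⁻¹ ∈ MulAut.conj t₁ •
              ((MulAut.conj g • (M.toTemperedCurve.inertia x).map M.inclX) ⊓ (M.GtpXu l).map M.inclX))) →
        n₀ ∈ M.GtpYdd)
    {x : M.Pt} (hx : M.IsCusp x) (g : M.GtpC)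
    {t : (ofCoverModel e C μ hC hS hl hp2 hpl hζ hη ι hι hinj Φ hΦ hΦK hZ hN T).Corhat}
    (ht : t ∈ (ofCoverModel e C μ hC hS hl hp2 hpl hζ hη ι hι hinj Φ hΦ hΦK hZ hN T).piPM) :
    (ofCoverModel e C μ hC hS hl hp2 hpl hζ hη ι hι hinj Φ hΦ hΦK hZ hN T).cuspDecomp
        (MulAut.conj t •
          (((MulAut.conj g • (M.toTemperedCurve.inertia x).map M.inclX) ⊓ (M.GtpXu l).map M.inclX).map
            ι.toMonoidHom :
            Subgroup (ofCoverModel e C μ hC hS hl hp2 hpl hζ hη ι hι hinj Φ hΦ hΦK hZ hN T).Corhat)) 1 ≤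
      (T.YddL).map ((ofCoverModel e C μ hC hS hl hp2 hpl hζ hη ι hι hinj Φ hΦ hΦK hZ hN T).emb.comp T.incl) := by
  intro n hn
  rw [piPM_ofCoverModel] at ht
  obtain ⟨t₁, ht₁, rfl⟩ := ht
  rw [PlusMinusTower.mem_cuspDecomp_iff, map_conj_one₃, map_conj_one₃, piV_ofCoverModel] at hn
  obtain ⟨hnV, hnN⟩ := hn
  obtain ⟨_, ⟨n₀, hn₀, rfl⟩, rfl⟩ := hnV
  rw [map_YddL_ofCoverModel]
  refine ⟨M.inclX n₀, ⟨n₀, ⟨?_, hn₀⟩, rfl⟩, rfl⟩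
  refine hX x hx g t₁ ht₁ n₀ hn₀ fun h hh => ?_
  have hinj' : Function.Injective ι.toMonoidHom := hinj
  have key : (ι.toMonoidHom h ∈ (MulAut.conj (ι.toMonoidHom t₁) •
        (((MulAut.conj g • (M.toTemperedCurve.inertia x).map M.inclX) ⊓ (M.GtpXu l).map M.inclX).map
          ι.toMonoidHom) : Subgroup Q)) ↔
      ι.toMonoidHom (M.inclX n₀) * ι.toMonoidHom h * (ι.toMonoidHom (M.inclX n₀))⁻¹ ∈
        (MulAut.conj (ι.toMonoidHom t₁) •
          (((MulAut.conj g • (M.toTemperedCurve.inertia x).map M.inclX) ⊓ (M.GtpXu l).map M.inclX).map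
            ι.toMonoidHom) : Subgroup Q) :=
    hnN (ι.toMonoidHom h) ⟨h, hh, rfl⟩
  rw [← map_conj_smul₃, Subgroup.mem_map_iff_mem hinj', ← map_mul, ← map_inv, ← map_mul,
    Subgroup.mem_map_iff_mem hinj'] at key
  exact key

/-- **Core of (a.2) for print's `Π_v`-level member `J ∩ Π_v`** ([IUTchII] Def. 2.3 (ii) p. 68 «intersections with `Π_⊆`»;
Cor. 2.4 (ii)(a) p. 70): `N_{Π_v}(J ∩ Π_v) ⊆` the image of `Π^tp_{Ÿ̲_v}` for every member `J` of the tempered cusp family,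
given `hX`.  PROVED (`cuspDecomp_inf_piV` ∘ `…_of_shape`). [claim: Mochizuki2012, status: disputed] (IUTchII §2 Cor 2.4 (ii)(a) p.70) -/
theorem cuspDecomp_one_inf_piV_le_map_YddL_ofCoverModel_of_shape
    (hX : ∀ (x : M.Pt), M.IsCusp x → ∀ (g t₁ : M.GtpC), t₁ ∈ (M.GtpXu l).map M.inclX →
      ∀ n₀ : M.PiTemp, n₀ ∈ C.Huu →
        (∀ h : M.GtpC, h ∈ (C.Huu : Subgroup M.PiTemp).map M.inclX →
          (h ∈ MulAut.conj t₁ •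
              ((MulAut.conj g • (M.toTemperedCurve.inertia x).map M.inclX) ⊓ (M.GtpXu l).map M.inclX) ↔
            M.inclX n₀ * h * (M.inclX n₀)⁻¹ ∈ MulAut.conj t₁ •
              ((MulAut.conj g • (M.toTemperedCurve.inertia x).map M.inclX) ⊓ (M.GtpXu l).map M.inclX))) →
        n₀ ∈ M.GtpYdd)
    {x : M.Pt} (hx : M.IsCusp x) (g : M.GtpC)
    {t : (ofCoverModel e C μ hC hS hl hp2 hpl hζ hη ι hι hinj Φ hΦ hΦK hZ hN T).Corhat}
    (ht : t ∈ (ofCoverModel e C μ hC hS hl hp2 hpl hζ hη ι hι hinj Φ hΦ hΦK hZ hN T).piPM) :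
    (ofCoverModel e C μ hC hS hl hp2 hpl hζ hη ι hι hinj Φ hΦ hΦK hZ hN T).cuspDecomp
        ((MulAut.conj t •
          (((MulAut.conj g • (M.toTemperedCurve.inertia x).map M.inclX) ⊓ (M.GtpXu l).map M.inclX).map
            ι.toMonoidHom :
            Subgroup (ofCoverModel e C μ hC hS hl hp2 hpl hζ hη ι hι hinj Φ hΦ hΦK hZ hN T).Corhat)) ⊓
          (ofCoverModel e C μ hC hS hl hp2 hpl hζ hη ι hι hinj Φ hΦ hΦK hZ hN T).piV) 1 ≤
      (T.YddL).map ((ofCoverModel e C μ hC hS hl hp2 hpl hζ hη ι hι hinj Φ hΦ hΦK hZ hN T).emb.comp T.incl) := by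
  rw [cuspDecomp_inf_piV]
  exact cuspDecomp_one_le_map_YddL_ofCoverModel_of_shape e C μ hC hS hl hp2 hpl hζ hη ι hι hinj Φ hΦ hΦK hZ hN T hX hx g ht

/-! ### §2. The producer re-keyed at the level `Π^±_v` (containment datum of p430433) -/

/-- **Non-vacuity at `Π^±_v`**: for the containment-keyed datum `Cu` (abc-iut-w5-d132's characterisation `hchar`, VERBATIM),
every member of the tempered cusp family IS `Cu`-cuspidal in `Π^±_v = ι(inclX Π^tp_{X̲})` (it lies in `Π^±_v`: an intersection
with `inclX Π^tp_{X̲}`, conjugated inside `Π^±_v`); in particular the `Π^±_v`-family is inhabited as soon as `X` has a cusp —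
in contrast with the level `Π_v` (abc-iut-w4-d005's `isEmpty_cuspidalInertia_piV_of_containment`).  PROVED.
[claim: Mochizuki2012, status: disputed] (IUTchII §2 Def 2.3 (ii), kurims p.68) -/
theorem isCuspidalInertia_piPM_of_containment
    (Cu : CuspidalInertiaData (ofCoverModel e C μ hC hS hl hp2 hpl hζ hη ι hι hinj Φ hΦ hΦK hZ hN T))
    (hchar : ∀ Q' J : Subgroup (ofCoverModel e C μ hC hS hl hp2 hpl hζ hη ι hι hinj Φ hΦ hΦK hZ hN T).Corhat,
      Cu.IsCuspidalInertia Q' J ↔ J ≤ Q' ∧ ∃ i : {x : M.Pt // M.IsCusp x} × M.GtpC,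
        ∃ t ∈ (ofCoverModel e C μ hC hS hl hp2 hpl hζ hη ι hι hinj Φ hΦ hΦK hZ hN T).piPM,
          J = MulAut.conj t •
            (((MulAut.conj i.2 • (M.toTemperedCurve.inertia i.1.1).map M.inclX) ⊓ (M.GtpXu l).map M.inclX).map
              ι.toMonoidHom :
              Subgroup (ofCoverModel e C μ hC hS hl hp2 hpl hζ hη ι hι hinj Φ hΦ hΦK hZ hN T).Corhat))
    {x : M.Pt} (hx : M.IsCusp x) (g : M.GtpC)
    {t : (ofCoverModel e C μ hC hS hl hp2 hpl hζ hη ι hι hinj Φ hΦ hΦK hZ hN T).Corhat}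
    (ht : t ∈ (ofCoverModel e C μ hC hS hl hp2 hpl hζ hη ι hι hinj Φ hΦ hΦK hZ hN T).piPM) :
    Cu.IsCuspidalInertia (ofCoverModel e C μ hC hS hl hp2 hpl hζ hη ι hι hinj Φ hΦ hΦK hZ hN T).piPM
      (MulAut.conj t •
        (((MulAut.conj g • (M.toTemperedCurve.inertia x).map M.inclX) ⊓ (M.GtpXu l).map M.inclX).map
          ι.toMonoidHom :
          Subgroup (ofCoverModel e C μ hC hS hl hp2 hpl hζ hη ι hι hinj Φ hΦ hΦK hZ hN T).Corhat)) := by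
  refine (hchar _ _).mpr ⟨?_, ⟨⟨x, hx⟩, g⟩, t, ht, rfl⟩
  have hle : (((MulAut.conj g • (M.toTemperedCurve.inertia x).map M.inclX) ⊓ (M.GtpXu l).map M.inclX).map
        ι.toMonoidHom : Subgroup (ofCoverModel e C μ hC hS hl hp2 hpl hζ hη ι hι hinj Φ hΦ hΦK hZ hN T).Corhat) ≤
      (ofCoverModel e C μ hC hS hl hp2 hpl hζ hη ι hι hinj Φ hΦ hΦK hZ hN T).piPM := by
    rw [piPM_ofCoverModel]
    exact Subgroup.map_mono inf_le_right
  exact conj_smul_le_of_le_of_mem hle ht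

/-- **The `Π^±_v`-family of the containment datum is INHABITED** (given a cusp `x₀` of `X`).  PROVED (`t = 1`, `g = 1`).
[claim: Mochizuki2012, status: disputed] (IUTchII §2 Def 2.3 (ii), kurims p.68) -/
theorem exists_isCuspidalInertia_piPM_of_containment
    (Cu : CuspidalInertiaData (ofCoverModel e C μ hC hS hl hp2 hpl hζ hη ι hι hinj Φ hΦ hΦK hZ hN T))
    (hchar : ∀ Q' J : Subgroup (ofCoverModel e C μ hC hS hl hp2 hpl hζ hη ι hι hinj Φ hΦ hΦK hZ hN T).Corhat,
      Cu.IsCuspidalInertia Q' J ↔ J ≤ Q' ∧ ∃ i : {x : M.Pt // M.IsCusp x} × M.GtpC,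
        ∃ t ∈ (ofCoverModel e C μ hC hS hl hp2 hpl hζ hη ι hι hinj Φ hΦ hΦK hZ hN T).piPM,
          J = MulAut.conj t •
            (((MulAut.conj i.2 • (M.toTemperedCurve.inertia i.1.1).map M.inclX) ⊓ (M.GtpXu l).map M.inclX).map
              ι.toMonoidHom :
              Subgroup (ofCoverModel e C μ hC hS hl hp2 hpl hζ hη ι hι hinj Φ hΦ hΦK hZ hN T).Corhat))
    {x₀ : M.Pt} (hx₀ : M.IsCusp x₀) :
    ∃ J, Cu.IsCuspidalInertia (ofCoverModel e C μ hC hS hl hp2 hpl hζ hη ι hι hinj Φ hΦ hΦK hZ hN T).piPM J :=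
  ⟨_, isCuspidalInertia_piPM_of_containment e C μ hC hS hl hp2 hpl hζ hη ι hι hinj Φ hΦ hΦK hZ hN T Cu hchar hx₀ 1
    (Subgroup.one_mem _)⟩

/-- **(a.2) RE-KEYED AT `Π^±_v`** (abc-iut-w4-d005's row, STATUS 11:53:15Z): over the containment datum, `N_{Π_v}(I) ⊆` the image
of `Π^tp_{Ÿ̲_v}` for every `Cu`-cuspidal inertia group `I` OF `Π^±_v` — the v1 statement with `Π_v` replaced by `Π^±_v` in the
binder (and `I ≤ Δ_{v□}` dropped), where the family is inhabited; `hX` abstract.  PROVED.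
[claim: Mochizuki2012, status: disputed] (IUTchII §2 Cor 2.4 (ii)(a) p.70) -/
theorem cuspDecomp_one_le_map_YddL_ofCoverModel_piPM_of_piTemp
    (Cu : CuspidalInertiaData (ofCoverModel e C μ hC hS hl hp2 hpl hζ hη ι hι hinj Φ hΦ hΦK hZ hN T))
    (hchar : ∀ Q' J : Subgroup (ofCoverModel e C μ hC hS hl hp2 hpl hζ hη ι hι hinj Φ hΦ hΦK hZ hN T).Corhat,
      Cu.IsCuspidalInertia Q' J ↔ J ≤ Q' ∧ ∃ i : {x : M.Pt // M.IsCusp x} × M.GtpC,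
        ∃ t ∈ (ofCoverModel e C μ hC hS hl hp2 hpl hζ hη ι hι hinj Φ hΦ hΦK hZ hN T).piPM,
          J = MulAut.conj t •
            (((MulAut.conj i.2 • (M.toTemperedCurve.inertia i.1.1).map M.inclX) ⊓ (M.GtpXu l).map M.inclX).map
              ι.toMonoidHom :
              Subgroup (ofCoverModel e C μ hC hS hl hp2 hpl hζ hη ι hι hinj Φ hΦ hΦK hZ hN T).Corhat))
    (hX : ∀ (x : M.Pt), M.IsCusp x → ∀ (g t₁ : M.GtpC), t₁ ∈ (M.GtpXu l).map M.inclX →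
      ∀ n₀ : M.PiTemp, n₀ ∈ C.Huu →
        (∀ h : M.GtpC, h ∈ (C.Huu : Subgroup M.PiTemp).map M.inclX →
          (h ∈ MulAut.conj t₁ •
              ((MulAut.conj g • (M.toTemperedCurve.inertia x).map M.inclX) ⊓ (M.GtpXu l).map M.inclX) ↔
            M.inclX n₀ * h * (M.inclX n₀)⁻¹ ∈ MulAut.conj t₁ •
              ((MulAut.conj g • (M.toTemperedCurve.inertia x).map M.inclX) ⊓ (M.GtpXu l).map M.inclX))) →
        n₀ ∈ M.GtpYdd) :
    ∀ I : Subgroup (ofCoverModel e C μ hC hS hl hp2 hpl hζ hη ι hι hinj Φ hΦ hΦK hZ hN T).Corhat,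
      Cu.IsCuspidalInertia (ofCoverModel e C μ hC hS hl hp2 hpl hζ hη ι hι hinj Φ hΦ hΦK hZ hN T).piPM I →
        (ofCoverModel e C μ hC hS hl hp2 hpl hζ hη ι hι hinj Φ hΦ hΦK hZ hN T).cuspDecomp I 1 ≤
          (T.YddL).map ((ofCoverModel e C μ hC hS hl hp2 hpl hζ hη ι hι hinj Φ hΦ hΦK hZ hN T).emb.comp T.incl) := by
  intro I hI
  obtain ⟨-, ⟨⟨x, hx⟩, g⟩, t, ht, rfl⟩ := (hchar _ _).mp hI
  exact cuspDecomp_one_le_map_YddL_ofCoverModel_of_shape e C μ hC hS hl hp2 hpl hζ hη ι hι hinj Φ hΦ hΦK hZ hN T hX hx g ht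

/-- **(a.2) RE-KEYED AT `Π^±_v`, DISCHARGED MODULO THE NAMED CUSP CLAUSES**: as above with `hX` derived (v1
`piTemp_hX_of_cuspClauses`) from the instance forms at `X` of [SemiAnbd] Thm. 6.5 (iii) (F-1704 `IsoPreservesCuspidalDecomp`) and (ii)
(F-1708 `DecompEqCommensuratorOfOpenInertia`) and the cusp-splitting clause «`D_x ⊆ Π^tp_{Y₂}`» (G-w6d069-1 at `N = 2`) — hypotheses,
by name.  PROVED. [claim: Mochizuki2012, status: disputed] (IUTchII §2 Cor 2.4 (ii)(a) p.70) -/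
theorem cuspDecomp_one_le_map_YddL_ofCoverModel_piPM
    (Cu : CuspidalInertiaData (ofCoverModel e C μ hC hS hl hp2 hpl hζ hη ι hι hinj Φ hΦ hΦK hZ hN T))
    (hchar : ∀ Q' J : Subgroup (ofCoverModel e C μ hC hS hl hp2 hpl hζ hη ι hι hinj Φ hΦ hΦK hZ hN T).Corhat,
      Cu.IsCuspidalInertia Q' J ↔ J ≤ Q' ∧ ∃ i : {x : M.Pt // M.IsCusp x} × M.GtpC,
        ∃ t ∈ (ofCoverModel e C μ hC hS hl hp2 hpl hζ hη ι hι hinj Φ hΦ hΦK hZ hN T).piPM,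
          J = MulAut.conj t •
            (((MulAut.conj i.2 • (M.toTemperedCurve.inertia i.1.1).map M.inclX) ⊓ (M.GtpXu l).map M.inclX).map
              ι.toMonoidHom :
              Subgroup (ofCoverModel e C μ hC hS hl hp2 hpl hζ hη ι hι hinj Φ hΦ hΦK hZ hN T).Corhat))
    (habs : M.toTemperedCurve.IsoPreservesCuspidalDecomp M.toTemperedCurve)
    (hcomm : M.toTemperedCurve.DecompEqCommensuratorOfOpenInertia)
    (hsplit : ∀ x : M.Pt, M.IsCusp x → M.decomp x ≤ M.GtpYN 2) :
    ∀ I : Subgroup (ofCoverModel e C μ hC hS hl hp2 hpl hζ hη ι hι hinj Φ hΦ hΦK hZ hN T).Corhat,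
      Cu.IsCuspidalInertia (ofCoverModel e C μ hC hS hl hp2 hpl hζ hη ι hι hinj Φ hΦ hΦK hZ hN T).piPM I →
        (ofCoverModel e C μ hC hS hl hp2 hpl hζ hη ι hι hinj Φ hΦ hΦK hZ hN T).cuspDecomp I 1 ≤
          (T.YddL).map ((ofCoverModel e C μ hC hS hl hp2 hpl hζ hη ι hι hinj Φ hΦ hΦK hZ hN T).emb.comp T.incl) :=
  cuspDecomp_one_le_map_YddL_ofCoverModel_piPM_of_piTemp e C μ hC hS hl hp2 hpl hζ hη ι hι hinj Φ hΦ hΦK hZ hN T Cu hchar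
    (piTemp_hX_of_cuspClauses (C := C) e hS hN habs hcomm hsplit)

/-- **(a.2) RE-KEYED AT `Π^±_v`, from the REGISTERED origin inputs** (R2 `Thm16Sub.GtpYNFromCusp` of `IsThm16Origin`, F-3213, and
(P3) `OncePuncturedData`; p438495's `ThetaSetting.decomp_inf_le_GtpYN_of_origin`).  PROVED.
[claim: Mochizuki2012, status: disputed] (IUTchII §2 Cor 2.4 (ii)(a) p.70) -/
theorem cuspDecomp_one_le_map_YddL_ofCoverModel_piPM_of_origin
    (Cu : CuspidalInertiaData (ofCoverModel e C μ hC hS hl hp2 hpl hζ hη ι hι hinj Φ hΦ hΦK hZ hN T))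
    (hchar : ∀ Q' J : Subgroup (ofCoverModel e C μ hC hS hl hp2 hpl hζ hη ι hι hinj Φ hΦ hΦK hZ hN T).Corhat,
      Cu.IsCuspidalInertia Q' J ↔ J ≤ Q' ∧ ∃ i : {x : M.Pt // M.IsCusp x} × M.GtpC,
        ∃ t ∈ (ofCoverModel e C μ hC hS hl hp2 hpl hζ hη ι hι hinj Φ hΦ hΦK hZ hN T).piPM,
          J = MulAut.conj t •
            (((MulAut.conj i.2 • (M.toTemperedCurve.inertia i.1.1).map M.inclX) ⊓ (M.GtpXu l).map M.inclX).map
              ι.toMonoidHom :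
              Subgroup (ofCoverModel e C μ hC hS hl hp2 hpl hζ hη ι hι hinj Φ hΦ hΦK hZ hN T).Corhat))
    (habs : M.toTemperedCurve.IsoPreservesCuspidalDecomp M.toTemperedCurve)
    (hcomm : M.toTemperedCurve.DecompEqCommensuratorOfOpenInertia)
    (hO : M.toThetaSetting.IsThm16Origin) (eO : M.toThetaSetting.OncePuncturedData) :
    ∀ I : Subgroup (ofCoverModel e C μ hC hS hl hp2 hpl hζ hη ι hι hinj Φ hΦ hΦK hZ hN T).Corhat,
      Cu.IsCuspidalInertia (ofCoverModel e C μ hC hS hl hp2 hpl hζ hη ι hι hinj Φ hΦ hΦK hZ hN T).piPM I →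
        (ofCoverModel e C μ hC hS hl hp2 hpl hζ hη ι hι hinj Φ hΦ hΦK hZ hN T).cuspDecomp I 1 ≤
          (T.YddL).map ((ofCoverModel e C μ hC hS hl hp2 hpl hζ hη ι hι hinj Φ hΦ hΦK hZ hN T).emb.comp T.incl) :=
  cuspDecomp_one_le_map_YddL_ofCoverModel_piPM e C μ hC hS hl hp2 hpl hζ hη ι hι hinj Φ hΦ hΦK hZ hN T Cu hchar habs hcomm
    (decomp_le_GtpYN_two_of_cuspSection hS (ThetaSetting.decomp_inf_le_GtpYN_of_origin M.toThetaSetting hO eO))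

/-! ### §3. The producer at `Π_v` for INTERSECTION-keyed data, in the closers' binder shape `hYdd` -/

/-- **(a.2) AT `Π_v` FOR PRINT'S INTERSECTION FAMILY, in the EXACT shape of the binder `hYdd` of the node's closers**
(`cor24_ii_iii'_of_inputs`, `…_of_levels_byName`, …): for ANY cuspidal datum `Ci` on `W := ofCoverModel …` whose `Π_v`-cuspidal
groups are traces `J ∩ Π_v` of members `J` of the tempered cusp family (Def. 2.3 (ii) p. 68, one direction of print's rule:
hypothesis `hint`), `D_t = N_{Π_v}(I) ⊆` the image of `Π^tp_{Ÿ̲_v}` for every `Ci`-cuspidal `I ⊆ Π_v`; `hX` abstract.  PROVED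
(`cuspDecomp_inf_piV` ∘ `…_of_shape`). [claim: Mochizuki2012, status: disputed] (IUTchII §2 Cor 2.4 (ii)(a) p.70; Def 2.3 (ii) p.68) -/
theorem cuspDecomp_one_le_map_YddL_ofCoverModel_of_inter_of_piTemp
    (Ci : CuspidalInertiaData (ofCoverModel e C μ hC hS hl hp2 hpl hζ hη ι hι hinj Φ hΦ hΦK hZ hN T))
    (hint : ∀ I : Subgroup (ofCoverModel e C μ hC hS hl hp2 hpl hζ hη ι hι hinj Φ hΦ hΦK hZ hN T).Corhat,
      Ci.IsCuspidalInertia (ofCoverModel e C μ hC hS hl hp2 hpl hζ hη ι hι hinj Φ hΦ hΦK hZ hN T).piV I →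
        ∃ i : {x : M.Pt // M.IsCusp x} × M.GtpC,
          ∃ t ∈ (ofCoverModel e C μ hC hS hl hp2 hpl hζ hη ι hι hinj Φ hΦ hΦK hZ hN T).piPM,
            I = (MulAut.conj t •
              (((MulAut.conj i.2 • (M.toTemperedCurve.inertia i.1.1).map M.inclX) ⊓ (M.GtpXu l).map M.inclX).map
                ι.toMonoidHom :
                Subgroup (ofCoverModel e C μ hC hS hl hp2 hpl hζ hη ι hι hinj Φ hΦ hΦK hZ hN T).Corhat)) ⊓
              (ofCoverModel e C μ hC hS hl hp2 hpl hζ hη ι hι hinj Φ hΦ hΦK hZ hN T).piV)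
    (hX : ∀ (x : M.Pt), M.IsCusp x → ∀ (g t₁ : M.GtpC), t₁ ∈ (M.GtpXu l).map M.inclX →
      ∀ n₀ : M.PiTemp, n₀ ∈ C.Huu →
        (∀ h : M.GtpC, h ∈ (C.Huu : Subgroup M.PiTemp).map M.inclX →
          (h ∈ MulAut.conj t₁ •
              ((MulAut.conj g • (M.toTemperedCurve.inertia x).map M.inclX) ⊓ (M.GtpXu l).map M.inclX) ↔
            M.inclX n₀ * h * (M.inclX n₀)⁻¹ ∈ MulAut.conj t₁ •
              ((MulAut.conj g • (M.toTemperedCurve.inertia x).map M.inclX) ⊓ (M.GtpXu l).map M.inclX))) →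
        n₀ ∈ M.GtpYdd)
    (H : Subgroup P) :
    ∀ I : Subgroup (ofCoverModel e C μ hC hS hl hp2 hpl hζ hη ι hι hinj Φ hΦ hΦK hZ hN T).Corhat,
      Ci.IsCuspidalInertia (ofCoverModel e C μ hC hS hl hp2 hpl hζ hη ι hι hinj Φ hΦ hΦK hZ hN T).piV I →
        I ≤ (ofCoverModel e C μ hC hS hl hp2 hpl hζ hη ι hι hinj Φ hΦ hΦK hZ hN T).deltaBox H →
          (ofCoverModel e C μ hC hS hl hp2 hpl hζ hη ι hι hinj Φ hΦ hΦK hZ hN T).cuspDecomp I 1 ≤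
            (T.YddL).map ((ofCoverModel e C μ hC hS hl hp2 hpl hζ hη ι hι hinj Φ hΦ hΦK hZ hN T).emb.comp T.incl) := by
  intro I hI _
  obtain ⟨⟨⟨x, hx⟩, g⟩, t, ht, rfl⟩ := hint I hI
  exact cuspDecomp_one_inf_piV_le_map_YddL_ofCoverModel_of_shape e C μ hC hS hl hp2 hpl hζ hη ι hι hinj Φ hΦ hΦK hZ hN T
    hX hx g ht

/-- **(a.2) AT `Π_v` FOR PRINT'S INTERSECTION FAMILY, DISCHARGED MODULO THE NAMED CUSP CLAUSES** (F-1704, F-1708, G-w6d069-1 at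
`N = 2`; v1 `piTemp_hX_of_cuspClauses`): the closers' `hYdd` for every intersection-keyed `Ci`.  PROVED.
[claim: Mochizuki2012, status: disputed] (IUTchII §2 Cor 2.4 (ii)(a) p.70; Def 2.3 (ii) p.68) -/
theorem cuspDecomp_one_le_map_YddL_ofCoverModel_of_inter
    (Ci : CuspidalInertiaData (ofCoverModel e C μ hC hS hl hp2 hpl hζ hη ι hι hinj Φ hΦ hΦK hZ hN T))
    (hint : ∀ I : Subgroup (ofCoverModel e C μ hC hS hl hp2 hpl hζ hη ι hι hinj Φ hΦ hΦK hZ hN T).Corhat,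
      Ci.IsCuspidalInertia (ofCoverModel e C μ hC hS hl hp2 hpl hζ hη ι hι hinj Φ hΦ hΦK hZ hN T).piV I →
        ∃ i : {x : M.Pt // M.IsCusp x} × M.GtpC,
          ∃ t ∈ (ofCoverModel e C μ hC hS hl hp2 hpl hζ hη ι hι hinj Φ hΦ hΦK hZ hN T).piPM,
            I = (MulAut.conj t •
              (((MulAut.conj i.2 • (M.toTemperedCurve.inertia i.1.1).map M.inclX) ⊓ (M.GtpXu l).map M.inclX).map
                ι.toMonoidHom :
                Subgroup (ofCoverModel e C μ hC hS hl hp2 hpl hζ hη ι hι hinj Φ hΦ hΦK hZ hN T).Corhat)) ⊓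
              (ofCoverModel e C μ hC hS hl hp2 hpl hζ hη ι hι hinj Φ hΦ hΦK hZ hN T).piV)
    (habs : M.toTemperedCurve.IsoPreservesCuspidalDecomp M.toTemperedCurve)
    (hcomm : M.toTemperedCurve.DecompEqCommensuratorOfOpenInertia)
    (hsplit : ∀ x : M.Pt, M.IsCusp x → M.decomp x ≤ M.GtpYN 2) (H : Subgroup P) :
    ∀ I : Subgroup (ofCoverModel e C μ hC hS hl hp2 hpl hζ hη ι hι hinj Φ hΦ hΦK hZ hN T).Corhat,
      Ci.IsCuspidalInertia (ofCoverModel e C μ hC hS hl hp2 hpl hζ hη ι hι hinj Φ hΦ hΦK hZ hN T).piV I →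
        I ≤ (ofCoverModel e C μ hC hS hl hp2 hpl hζ hη ι hι hinj Φ hΦ hΦK hZ hN T).deltaBox H →
          (ofCoverModel e C μ hC hS hl hp2 hpl hζ hη ι hι hinj Φ hΦ hΦK hZ hN T).cuspDecomp I 1 ≤
            (T.YddL).map ((ofCoverModel e C μ hC hS hl hp2 hpl hζ hη ι hι hinj Φ hΦ hΦK hZ hN T).emb.comp T.incl) :=
  cuspDecomp_one_le_map_YddL_ofCoverModel_of_inter_of_piTemp e C μ hC hS hl hp2 hpl hζ hη ι hι hinj Φ hΦ hΦK hZ hN T Ci hint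
    (piTemp_hX_of_cuspClauses (C := C) e hS hN habs hcomm hsplit) H

/-- **(a.2) AT `Π_v` FOR PRINT'S INTERSECTION FAMILY, from the REGISTERED origin inputs** (`IsThm16Origin` R2 / F-3213 and (P3)
`OncePuncturedData`, via p438495): the closers' `hYdd` for every intersection-keyed `Ci`, with F-1704/F-1708 as the only other inputs.
PROVED. [claim: Mochizuki2012, status: disputed] (IUTchII §2 Cor 2.4 (ii)(a) p.70; Def 2.3 (ii) p.68) -/
theorem cuspDecomp_one_le_map_YddL_ofCoverModel_of_inter_of_origin
    (Ci : CuspidalInertiaData (ofCoverModel e C μ hC hS hl hp2 hpl hζ hη ι hι hinj Φ hΦ hΦK hZ hN T))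
    (hint : ∀ I : Subgroup (ofCoverModel e C μ hC hS hl hp2 hpl hζ hη ι hι hinj Φ hΦ hΦK hZ hN T).Corhat,
      Ci.IsCuspidalInertia (ofCoverModel e C μ hC hS hl hp2 hpl hζ hη ι hι hinj Φ hΦ hΦK hZ hN T).piV I →
        ∃ i : {x : M.Pt // M.IsCusp x} × M.GtpC,
          ∃ t ∈ (ofCoverModel e C μ hC hS hl hp2 hpl hζ hη ι hι hinj Φ hΦ hΦK hZ hN T).piPM,
            I = (MulAut.conj t •
              (((MulAut.conj i.2 • (M.toTemperedCurve.inertia i.1.1).map M.inclX) ⊓ (M.GtpXu l).map M.inclX).map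
                ι.toMonoidHom :
                Subgroup (ofCoverModel e C μ hC hS hl hp2 hpl hζ hη ι hι hinj Φ hΦ hΦK hZ hN T).Corhat)) ⊓
              (ofCoverModel e C μ hC hS hl hp2 hpl hζ hη ι hι hinj Φ hΦ hΦK hZ hN T).piV)
    (habs : M.toTemperedCurve.IsoPreservesCuspidalDecomp M.toTemperedCurve)
    (hcomm : M.toTemperedCurve.DecompEqCommensuratorOfOpenInertia)
    (hO : M.toThetaSetting.IsThm16Origin) (eO : M.toThetaSetting.OncePuncturedData) (H : Subgroup P) :
    ∀ I : Subgroup (ofCoverModel e C μ hC hS hl hp2 hpl hζ hη ι hι hinj Φ hΦ hΦK hZ hN T).Corhat,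
      Ci.IsCuspidalInertia (ofCoverModel e C μ hC hS hl hp2 hpl hζ hη ι hι hinj Φ hΦ hΦK hZ hN T).piV I →
        I ≤ (ofCoverModel e C μ hC hS hl hp2 hpl hζ hη ι hι hinj Φ hΦ hΦK hZ hN T).deltaBox H →
          (ofCoverModel e C μ hC hS hl hp2 hpl hζ hη ι hι hinj Φ hΦ hΦK hZ hN T).cuspDecomp I 1 ≤
            (T.YddL).map ((ofCoverModel e C μ hC hS hl hp2 hpl hζ hη ι hι hinj Φ hΦ hΦK hZ hN T).emb.comp T.incl) :=
  cuspDecomp_one_le_map_YddL_ofCoverModel_of_inter e C μ hC hS hl hp2 hpl hζ hη ι hι hinj Φ hΦ hΦK hZ hN T Ci hint habs hcomm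
    (decomp_le_GtpYN_two_of_cuspSection hS (ThetaSetting.decomp_inf_le_GtpYN_of_origin M.toThetaSetting hO eO)) H

end PlusMinusTower

end Literature.IUT.HodgeArakelov

end
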